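import Summits.HodgeConjecture.HodgeConjecture.Theorems.DworkReflectionQuotientsGIByName
import Summits.HodgeConjecture.HodgeConjecture.Theorems.DworkReflectionQuotientsGIOfFacts
import Literature.AlgebraicGeometry.HodgeTheory.DworkSexticPencilHodgeLociOfGriffiths
import Literature.AlgebraicGeometry.HodgeTheory.DworkSexticPencilResidueClimb
import HarnessLib

/-!
# Route `DworkReflectionQuotients`: the crux `GenericInvariantHodgeClasses` and the rung leaf BY NAME with the
# pencil-specific Hodge-frames fact REPLACED by Griffiths' general theorem (Voisin I Thm. 10.3)

Route `route-HodgeConjecture-DworkReflectionQuotients` (cell `hodge-nonav`; FRONTIER rung F-H1 — never summit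
credit). Prover seat `hodge-nonav-20241-p1` (g12). SUPPORT FILE (`--supports stmt-HodgeConjecture-24129`;
CONDITIONAL results, nothing here closes an item).

State before (g9∕g10, file `DworkReflectionQuotientsGIByName`): every open item decl of the route and the rung
leaf has a by-name theorem modulo the four print-verbatim named facts {`DworkSextic.BiniGarbagnati2012_reflectionQuotient_isFano`,
`Motives.KollarMiyaokaMori1992_fano_rationallyChainConnected`, `DworkSextic.Griffiths1968_dworkPencil_holomorphicHodgeFrames`,
`DworkSextic.Voisin2003_dworkPencil_residues_infinitesimal`}. The third one is a restatement, for the Dwork pencil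
only, of Griffiths' theorem on the holomorphy of the Hodge bundles. The tree now holds the GENERAL statement as
the named fact `Griffiths1968_holomorphicHodgeSubbundles` (`Literature/…/GriffithsHolomorphicHodgeSubbundles`, Voisin I
Thm. 10.3 for every smooth projective family over a smooth quasi-projective base — the statement the
Baldi–Klingler–Ullmo line consumes), and the tree theorem
`DworkSextic.Voisin2002_dworkPencil_hodgeFiltrationTwo_locus_dichotomy_of_griffiths1968`
(`Literature/…/DworkSexticPencilHodgeLociOfGriffiths`) derives the route's analytic input from it. Hence:

* `genericInvariantHodgeClasses_of_griffiths1968_of_residues` — crux GI (stmt-HodgeConjecture-24129) BY NAME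
  modulo {`Griffiths1968_holomorphicHodgeSubbundles`, `DworkSextic.Voisin2003_dworkPencil_residues_infinitesimal`};
* `genericHodgeClassesFlat_of_isFano_of_KMM_of_griffiths1968_of_residues` — support `GenericHodgeClassesFlat`
  (stmt-HodgeConjecture-20243) BY NAME modulo the four facts with the general Griffiths fact in third place;
* `dworkSexticHodge_of_isFano_of_KMM_of_griffiths1968_of_residues` — the rung leaf `DworkSexticHodge` BY NAME
  modulo {Bini–Garbagnati Prop. 3.20, Kollár–Miyaoka–Mori, Griffiths 1968 (general), Carlson–Griffiths
  residues along the pencil}.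

NET for the F-H1 ledger: the route's residual print dependence no longer contains a Dwork-specific Hodge-theory
fact for `F²𝓗⁴`; it shares `Griffiths1968_holomorphicHodgeSubbundles` with the BKU line
(`bku_finite_monodromyOrbit_of_isHodgeGenericIn_of_griffiths1968`). Honest scope: conditional structure
theorems; nothing here says HC, HC_CM or HC_AV is proved; rung F-H1 not moved.

## References

* [VoisinHodgeI2002] C. Voisin, Hodge Theory and Complex Algebraic Geometry I (2002), §10.2.1 Thm. 10.3.
* [VoisinHodgeII2003] C. Voisin, Hodge Theory and Complex Algebraic Geometry II (2003), §5.3.1 Lemma 5.13,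
  §6.1–§6.2, Thm. 6.24 (proof).
* [BiniGarbagnati2012] G. Bini, A. Garbagnati, Quotients of the Dwork pencil, J. Geom. Phys. 75 (2014), Prop. 3.20.
* [KollarMiyaokaMori1992] J. Kollár, Y. Miyaoka, S. Mori, Rational connectedness and boundedness of Fano
  manifolds, J. Differential Geom. 36 (1992), Thm. 0.1.
-/

-- mandated namespace `Summit.HodgeConjecture.HodgeConjecture.Theorems` trips `linter.dupNamespace` (off tree-wide)
set_option linter.dupNamespace false

namespace Summit.HodgeConjecture.HodgeConjecture.Theorems

open Literature.AlgebraicGeometry.HodgeTheory Literature.AlgebraicGeometry.Motives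

/-- **Crux GI `GenericInvariantHodgeClasses` (stmt-HodgeConjecture-24129) BY NAME modulo Griffiths' GENERAL
theorem and the Carlson–Griffiths residues along the pencil**: the dichotomy input is
`Voisin2002_dworkPencil_hodgeFiltrationTwo_locus_dichotomy_of_griffiths1968 hG`, the climb input is
`Voisin2003_dworkPencil_invariantFlatSection_climb_of_residues hres`, composed by `genericInvariantHodgeClasses_of_facts`.
CONDITIONAL; rung F-H1 not moved. [cite: VoisinHodgeI2002, §10.2.1 Thm. 10.3]
[cite: VoisinHodgeII2003, Thm. 6.13 and Thm. 6.24 (proof)] -/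
theorem genericInvariantHodgeClasses_of_griffiths1968_of_residues
    (hG : Griffiths1968_holomorphicHodgeSubbundles)
    (hres : DworkSextic.Voisin2003_dworkPencil_residues_infinitesimal) :
    Summit.HodgeConjecture.HodgeConjecture.Theses.DworkReflectionQuotients.GenericInvariantHodgeClasses :=
  genericInvariantHodgeClasses_of_facts
    (DworkSextic.Voisin2002_dworkPencil_hodgeFiltrationTwo_locus_dichotomy_of_griffiths1968 hG)
    (DworkSextic.Voisin2003_dworkPencil_invariantFlatSection_climb_of_residues hres)

/-- **The support `GenericHodgeClassesFlat` (stmt-HodgeConjecture-20243) BY NAME from {Bini–Garbagnati 3.20,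
Kollár–Miyaoka–Mori, Griffiths 1968 (general), pencil residues}.** CONDITIONAL; rung F-H1 not moved.
[cite: BiniGarbagnati2012, Prop. 3.20] [cite: VoisinHodgeII2003, Thm. 6.24 (proof)] -/
theorem genericHodgeClassesFlat_of_isFano_of_KMM_of_griffiths1968_of_residues
    (hF : DworkSextic.BiniGarbagnati2012_reflectionQuotient_isFano)
    (hK : KollarMiyaokaMori1992_fano_rationallyChainConnected)
    (hG : Griffiths1968_holomorphicHodgeSubbundles)
    (hres : DworkSextic.Voisin2003_dworkPencil_residues_infinitesimal) :
    Summit.HodgeConjecture.HodgeConjecture.Theses.DworkReflectionQuotients.GenericHodgeClassesFlat :=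
  genericHodgeClassesFlat_of_reflectionQuotientDescent_of_facts (reflectionQuotientDescent_of_isFano_of_KMM hF hK)
    (DworkSextic.Voisin2002_dworkPencil_hodgeFiltrationTwo_locus_dichotomy_of_griffiths1968 hG)
    (DworkSextic.Voisin2003_dworkPencil_invariantFlatSection_climb_of_residues hres)

/-- **The rung leaf `DworkSexticHodge` (HC for the very general Dwork sextic fourfold) BY NAME from the four
print facts {Bini–Garbagnati Prop. 3.20, Kollár–Miyaoka–Mori, Griffiths 1968 (GENERAL, Voisin I Thm. 10.3),
Carlson–Griffiths residues along the pencil}.** CONDITIONAL; FRONTIER rung F-H1, never summit credit; nothing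
here says HC, HC_CM or HC_AV is proved. [cite: BiniGarbagnati2012, Prop. 3.20] [cite: KollarMiyaokaMori1992, Thm. 0.1]
[cite: VoisinHodgeI2002, §10.2.1 Thm. 10.3] [cite: VoisinHodgeII2003, Thm. 6.13 and Thm. 6.24 (proof)] -/
theorem dworkSexticHodge_of_isFano_of_KMM_of_griffiths1968_of_residues
    (hF : DworkSextic.BiniGarbagnati2012_reflectionQuotient_isFano)
    (hK : KollarMiyaokaMori1992_fano_rationallyChainConnected)
    (hG : Griffiths1968_holomorphicHodgeSubbundles)
    (hres : DworkSextic.Voisin2003_dworkPencil_residues_infinitesimal) :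
    Summit.HodgeConjecture.HodgeConjecture.Theses.DworkPrymHodge.DworkSexticHodge :=
  dworkSexticHodge_of_reflectionQuotientDescent_of_facts (reflectionQuotientDescent_of_isFano_of_KMM hF hK)
    (DworkSextic.Voisin2002_dworkPencil_hodgeFiltrationTwo_locus_dichotomy_of_griffiths1968 hG)
    (DworkSextic.Voisin2003_dworkPencil_invariantFlatSection_climb_of_residues hres)

end Summit.HodgeConjecture.HodgeConjecture.Theorems
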